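import Literature.MathematicalPhysics.QuantumFieldTheory.Balaban1983to89.B9PerturbationMajorantLetters
import Literature.MathematicalPhysics.QuantumFieldTheory.Balaban1983to89.B9Thm312WholeL2

/-!
# `Balaban1983to89.B9Thm313WholeRgdFrom3152` — [B9] Theorem 3.13 (pp. 424–426): THE `RD*G₁`-LETTERS OF ROWS 20–21 ARE THEOREM 3.1's
# `RG′D*` BY THE PRINTED IDENTITY (3.152) — two displayed analytic letters of the Sect.-D leaves PROVED from rows 18's derived
# Theorem-3.1 majorants (`Thm31GpMaj`, h31) and (3.49) (`Proj349Maj`, h49), modulo the identity `RD*G₁ = RG′D*` displayed by name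

T. Bałaban, *Propagators for lattice gauge theories in a background field*, Commun. Math. Phys. **99** (1985) 389–434
[`Balaban1985BackgroundPropagators`, "B9"]; [4] = T. Bałaban, *Propagators and renormalization transformations for lattice gauge
theories. II*, Commun. Math. Phys. **96** (1984) 223–250 [`Balaban1984PropagatorsII`].

statement-level skeleton of published theorems with citation tags; proofs where landed; nothing here is a claim about the Yang–Mills
mass gap

THE PRINTED LOCUS (held text `paper:balaban1985-cmp99-background-propagators`, re-read by this seat).  p. 426, after (3.151): *"from this
integral we get R = Δ𝒮Δ … From these identities we get Q𝒮 = 𝒮Q′\* = 0 and Δ𝒮D\*J = Δ𝒮(Δ + Q′\*aQ′)G′D\*J = Δ𝒮ΔG′D\*J = RG′D\*J, hence (3.151)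
gives RD\*G₁ = RG′D\*, and G₁DR = DG′R. (3.152) Let us notice that these identities imply the identities (3.124), because QG₁DR = QDG′R =
D₁Q′G′R = 0"*; p. 426: *"The formulas (3.147), (3.153) permit us to reduce properties of the operators 𝔓, 𝔊 to the corresponding properties
of the operators G′, (Q′G′²Q′\*)⁻¹, G₁, (QG₁Q\*)⁻¹"*; Theorem 3.1 (3.42) p. 397 (|(G′(U)∇\*_Uλ)(x)| ≦ B₀Lʲη·e^{−δ₀d(y,y′)}|λ|); (3.49) p. 399
(|P(x,x′)| ≦ O(1)(Lʲη)^{−d}… — P = I − R); (3.46) p. 398 (the block-L² members); p. 391 (the L² adjoints).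

THE POINT.  The rows-20–21 leaves of this lineage (`B9Thm313WholeLeafCompletePairMBCZ.thm313Printed_completePairMBCZ`, consumed by n06-d's
certificate editions `…N06AtOpsYNuOfRecordV6EPairN*`) display the Sect.-D letters of Theorem 3.13's 𝔊 = G₁ − G₁DRD\*G₁ − G₁Q\*(QG₁Q\*)⁻¹QG₁
((3.153)) as HYPOTHESIS SCHEMAS; among them the composites R∘D\*∘G₁∘F of the middle term — `Letters313Z.rgd2` (F = I, sup classes
𝔠⁽⁰⁾ → 𝔠_W⁽¹⁾), `Letters313L2PZ.rgdI` (F = I, block-L²), and their derivative twins.  Print never estimates RD\*G₁ directly: by (3.152) it IS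
RG′D\*, i.e. Theorem 3.1's member G′∇\*_U of the SITE propagator G′ ((3.42)₃ — for the scalar G′ the covariant derivative ∇_U of (3.3) IS
the gauge-mode derivative D of DRD\*, and ∇\*_U its adjoint D\*) followed by R = ϱ(I − P) with P's kernel bound (3.49).  Both inputs are
ALREADY DERIVED at the record's pins from rows 18's Theorem-3.7 leaf: `B9Thm31GpMajFromPinsPairM.thm31GpMaj_of_t37_pairM` (the schema
`B9PerturbationMajorantAlgebra.Thm31GpMaj`, the certificate's former binder h31) and `B9Proj349MajFromBlocks.proj349Maj_of_blockSchemas`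
(`Proj349Maj`, the former h49).  THIS FILE types the reduction:
* §1 `Ids3152 𝔬 Gp U` — (3.152) VERBATIM as two operator identities at the letter record (`rd : R∘D\*∘G₁ = R∘G′∘D\*`, `dr : G₁∘D∘R =
  D∘G′∘R`), with G′ a letter `Gp : B.Cfg → Module.End ℝ (W → ℝ)` on the scalar carrier (the module-level twin of the ring hypotheses
  `h152a ∕ h152b` of `B9.frakG_3153`).  A HYPOTHESIS SCHEMA of a PRINTED IDENTITY; nothing asserted (its proof in print is the Gaussian
  computation (3.151) + [4] (2.26)–(2.27); at def-Y's letters it is in the class of `B9Thm312WholeIdentitiesSplit.Ids3124`, which it implies).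
* §2 ★★ `rgd2_of_ids3152` — `Letters313Z.rgd2`'s statement PROVED from `Ids3152.rd`, `Thm31GpMaj`, `Proj349Maj`, `R = ϱ•(I − P)`, the row
  sum ([4] (2.61)) and the member facts `Facts347` (p. 398's transfer), through `B9PerturbationMajorantLetters.maj_RGpDvs` (𝒮 = RG′D\* :
  𝔠⁽⁰⁾ → 𝔠_W^{(−1)}, constant `constA ϱ B₀ C_P c L`, rate r − σ − αδ): any B₃ ≧ `constA …`, any 0 ≦ δ₃ ≦ r − σ − αδ.
* §3 ★ `rgdI_of_ids3152` — `Letters313L2PZ.rgdI`'s statement (‖1_{Δ(y)}RD\*G₁μ‖₂ ≦ B₄·L^{j′}η·e^{−δd(y,y′)}‖μ‖₂) from the same letters plus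
  the transposition letters (G′ symmetric, Dᵀ = D\*, P symmetric; p. 391): G′D\* in block-L² by n06-k's Schur lemma with p. 398's transfer
  (`B9Thm312WholeFromThm310L2`-pattern `blockBd_l1_of_sup`, here `B9RWSums346Schur.blockBd_entry2` read through the adjoint), P in block-L² by
  the Schur test, one composition at the margin σ.

HONEST SCOPE.  Kernel bookkeeping over landed modules: two displayed ANALYTIC letters of rows 20–21 become theorems of rows 18's DERIVED
material and ONE displayed printed IDENTITY (count: −2 estimate-type binder fields, +1 identity binder at the certificate; the knit —
dag-n06-d — decides).  NOTHING of print's estimates is asserted; (3.152) is NOT proved here.  The remaining R∇\*G₁-letters (`rgd1`, `rgdH`,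
`rgdDs`, `rgdDd`, `rgdDds`, `rgdd`) reduce by the same identity to SECOND-order or Hölder-class members of G′ (G′D\*∇\*_U, G′D\* into a Hölder
class) that `Thm31GpMaj` does not carry — not typed here.  COUNT-NEUTRAL; N06 NOT discharged; one finite lattice at a time; nothing
continuum, nothing about the mass gap.  Cell `pub-ymgap` (HUMAN RULING D-0062), Track A node N06 [B9], N06-ASSIGNMENT v1 rows 20–21
(bundle F7), seat `pub-ymgap-dag-n06-l` (g16), 2026-08-28.
-/

namespace Literature.MathematicalPhysics.QuantumFieldTheory.Balaban1983to89.B9Thm313WholeRgdFrom3152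

open Literature.MathematicalPhysics.QuantumFieldTheory.Balaban1983to89
open Finset B6RandomWalk B6RandomWalkHom B9Thm34Ext B11SectG B9SectDSup B9SectDL2Decay B9Thm37Glue B9Thm312Whole
open B9Thm312WholeClasses B9RWSums343to347Whole B9RWSums346Schur B9PerturbationMajorantAlgebra B9PerturbationMajorantLetters

noncomputable section

variable {g : B9.Geometry} {B : B9.Backgrounds} {X Y Z W : Type} [Fintype X] [Fintype W] [Fintype g.Site]
variable {R₀ : ℝ} {H₀ : Prop}

/-! ## §1 The printed identity (3.152) at the letter record (nothing asserted) -/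

/-- **(3.152) AT THE LETTERS**: *"RD\*G₁ = RG′D\*, and G₁DR = DG′R"* (p. 426) — the two operator identities tying the gauge-sector
propagator G₁ of (3.128) to the SITE propagator G′ of Theorem 3.1 through the operators D, D\*, R of DRD\*, read on the letter record
`B9Thm312Whole.Ops` (fields `R`, `Dvstar`, `G1`, `Dv`) and a letter `Gp U : Module.End ℝ (W → ℝ)` for G′(U) on the scalar carrier `W`.
The module-level twin of the ring hypotheses `h152a`, `h152b` of `B9.frakG_3153`.  A HYPOTHESIS SCHEMA of a printed identity — its
printed proof is the Gaussian computation (3.151) with [4] (2.26)–(2.27) (R = Δ𝒮Δ, 𝒮Q′\* = 0); nothing is asserted here, and print notes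
that it implies (3.124) (`B9Thm312WholeIdentitiesSplit.Ids3124`). [cite: Balaban1985BackgroundPropagators, (3.152) p.426 + (3.151) p.425 + (3.124) p.420; Balaban1984PropagatorsII, (2.26)–(2.27) p.229] -/
structure Ids3152 (𝔬 : Ops g B X Y Z W) (Gp : B.Cfg → Module.End ℝ (W → ℝ)) (U : B.Cfg) : Prop where
  rd : 𝔬.R U ∘ₗ 𝔬.Dvstar U ∘ₗ 𝔬.G1 U = 𝔬.R U ∘ₗ Gp U ∘ₗ 𝔬.Dvstar U
  dr : 𝔬.G1 U ∘ₗ 𝔬.Dv U ∘ₗ 𝔬.R U = 𝔬.Dv U ∘ₗ Gp U ∘ₗ 𝔬.R U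

omit [Fintype X] [Fintype W] [Fintype g.Site] in
/-- Pointwise form of `Ids3152.rd` on the letter of the leaves (R∘D\*∘G₁∘I). [cite: Balaban1985BackgroundPropagators, (3.152) p.426] -/
theorem Ids3152.rd_apply {𝔬 : Ops g B X Y Z W} {Gp : B.Cfg → Module.End ℝ (W → ℝ)} {U : B.Cfg} (h : Ids3152 𝔬 Gp U) (μ : X → ℝ) :
    (𝔬.R U ∘ₗ 𝔬.Dvstar U ∘ₗ 𝔬.G1 U ∘ₗ LinearMap.id) μ = 𝔬.R U (Gp U (𝔬.Dvstar U μ)) := by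
  have e := LinearMap.congr_fun h.rd μ
  simp only [LinearMap.comp_apply] at e
  simp only [LinearMap.comp_apply, LinearMap.id_apply]
  exact e

omit [Fintype X] [Fintype W] [Fintype g.Site] in
/-- Pointwise form of `Ids3152.dr` (G₁∘D∘R = D∘G′∘R). [cite: Balaban1985BackgroundPropagators, (3.152) p.426] -/
theorem Ids3152.dr_apply {𝔬 : Ops g B X Y Z W} {Gp : B.Cfg → Module.End ℝ (W → ℝ)} {U : B.Cfg} (h : Ids3152 𝔬 Gp U) (s : W → ℝ) :
    𝔬.G1 U (𝔬.Dv U (𝔬.R U s)) = 𝔬.Dv U (Gp U (𝔬.R U s)) := by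
  have e := LinearMap.congr_fun h.dr s
  simpa only [LinearMap.comp_apply] using e

/-! ## §2 The sup letter `Letters313Z.rgd2` from (3.152), Theorem 3.1 and (3.49) -/

/-- ★★ **THE LETTER R∇\*G₁ : 𝔠⁽⁰⁾ → 𝔠_W⁽¹⁾ OF ROWS 20–21 (`Letters313Z.rgd2`) IS THEOREM 3.1's RG′∇\* BY (3.152)** — PROVED from the identity
`Ids3152.rd`, Theorem 3.1 (3.42)₁₂₃ for G′ in the [4]-(2.51) shapes (`Thm31GpMaj`, rows 18's derived h31), (3.49) for P (`Proj349Maj`, the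
derived h49), the letter R = ϱ•(I − P) (def-Y's `rcoK_eq` at the pins), [4] Lemma 2.1's row sum at the margin σ and the member facts of
p. 398's transfer (`Facts347` at (δ, α)): via `B9PerturbationMajorantLetters.maj_RGpDvs` the composite RG′D\* maps 𝔠⁽⁰⁾ into 𝔠_W^{(−1)}
with `constA ϱ B₀ C_P c L·e^{−(r−σ−αδ)d}` for any r ≦ min(δ₀, δ_P) with r − σ − αδ ≧ 0; hence the displayed shape with any B₃ ≧ `constA …`
and any rate 0 ≦ δ₃ ≦ r − σ − αδ.  Nothing of print asserted ((3.152) enters by name).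
[cite: Balaban1985BackgroundPropagators, (3.152)–(3.153) p.426 + Thm 3.1 (3.42) p.397 + (3.49) p.399 + Thm 3.13 p.426; Balaban1984PropagatorsII, (2.52)–(2.56) pp.232–233 + Lemma 2.1 (2.60)–(2.61) p.234] -/
theorem rgd2_of_ids3152 (hG : GeoOK g) {dF : ℕ} {δ α L₀ σ c : ℝ} (hF : Facts347 g R₀ H₀ dF δ α L₀)
    (hrow : RowSum (toB6 g R₀ H₀) σ c) {𝔬 : Ops g B X Y Z W} {Gp P : B.Cfg → Module.End ℝ (W → ℝ)} {U : B.Cfg}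
    {B₀ δ₀ CP δP ϱ r B₃ δ₃ : ℝ}
    (h31 : Thm31GpMaj 𝔬.blkW 𝔬.blk (Gp U) (𝔬.Dv U) (𝔬.Dvstar U) R₀ H₀ B₀ δ₀)
    (h49 : Proj349Maj 𝔬.blkW 𝔬.blk (P U) (𝔬.Dv U) (𝔬.Dvstar U) R₀ H₀ CP δP)
    (hR : 𝔬.R U = ϱ • (LinearMap.id - P U)) (h152 : Ids3152 𝔬 Gp U)
    (hϱ : 0 ≤ ϱ) (hB₀ : 0 ≤ B₀) (hCP : 0 ≤ CP) (hc : 0 ≤ c) (hσ : 0 ≤ σ) (hτ : 0 ≤ α * δ)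
    (hrδ₀ : r ≤ δ₀) (hrδP : r ≤ δP) (hbud : 0 ≤ r - σ - α * δ)
    (hB₃ : constA ϱ B₀ CP c g.L ≤ B₃) (hδ₃ : δ₃ ≤ r - σ - α * δ) :
    HasMaj (cNorm R₀ H₀ 𝔬.blk hG.lenle 0) (cNorm R₀ H₀ 𝔬.blkW hG.lenle 1)
      (𝔬.R U ∘ₗ 𝔬.Dvstar U ∘ₗ 𝔬.G1 U ∘ₗ LinearMap.id) (fun a b => B₃ * Real.exp (-(δ₃ * g.dist a b))) := by
  -- 𝒮 = RG′D* : 𝔠⁽⁰⁾ → 𝔠_W^{(−1)}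
  have h := maj_RGpDvs hG hF hrow (h31.gpDvs_cls hG hB₀ hrδ₀) (h49.p_cls hG hCP hrδP) hR hϱ hB₀ hCP hc hσ hτ hbud
  -- weaken constant and rate
  have h' := hasMaj_weaken hG (constA_nonneg hϱ hB₀ hCP hc) hB₃ hδ₃ h
  -- to the integer-weight classes 𝔠⁽⁰⁾ → 𝔠⁽¹⁾
  have h'' : HasMaj (cNormR R₀ H₀ 𝔬.blk hG.lenle (-((0 : ℕ) : ℝ))) (cNormR R₀ H₀ 𝔬.blkW hG.lenle (-((1 : ℕ) : ℝ)))
      (𝔬.R U ∘ₗ Gp U ∘ₗ 𝔬.Dvstar U) (fun a b => B₃ * Real.exp (-(δ₃ * g.dist a b))) := by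
    simpa only [Nat.cast_zero, neg_zero, Nat.cast_one] using h'
  refine (hasMaj_ofR hG h'').congr fun μ => ?_
  rw [h152.rd_apply μ]
  rfl

/-! ## §3 The block-L² letter `Letters313L2PZ.rgdI` from (3.152), Theorem 3.1, (3.49) and the transposition letters -/

section L2

variable {F : Type} [AddCommGroup F] [Module ℝ F]

omit [Fintype X] in
/-- Scalars on a majorant into a weighted block-L² space: `r • T` has the majorant `|r|·K`. [folklore] -/
private theorem hasMaj_smul_l2w {b₁ : BlockNorm (toB6 g R₀ H₀) F} {blk : W → g.Site} {Wt : g.Site → ℝ} {hWt : ∀ y, 0 ≤ Wt y}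
    {T : F →ₗ[ℝ] (W → ℝ)} {K : g.Site → g.Site → ℝ} (h : HasMaj b₁ (l2w (toB6 g R₀ H₀) blk Wt hWt) T K) (r : ℝ) :
    HasMaj b₁ (l2w (toB6 g R₀ H₀) blk Wt hWt) (r • T) (fun a b => |r| * K a b) := by
  intro y' μ hμ y
  have hb := h y' μ hμ y
  rw [l2w_loc] at hb
  show Wt y * bl2 (g := toB6 g R₀ H₀) blk y ((r • T) μ) ≤ |r| * K y y' * b₁.loc y' μ
  rw [LinearMap.smul_apply, bl2_smul]
  calc Wt y * (|r| * bl2 (g := toB6 g R₀ H₀) blk y (T μ)) = |r| * (Wt y * bl2 (g := toB6 g R₀ H₀) blk y (T μ)) := by ring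
    _ ≤ |r| * (K y y' * b₁.loc y' μ) := mul_le_mul_of_nonneg_left hb (abs_nonneg r)
    _ = |r| * K y y' * b₁.loc y' μ := by ring

omit [Fintype X] [Fintype W] in
/-- Weakening the rate of a two-space sup majorant C·Lʲη·e^{−δd} (C ≧ 0, d ≧ 0). [folklore] -/
private theorem hom_rate_le {V₁ V₂ : Type} {blk₁ : V₁ → g.Site} {blk₂ : V₂ → g.Site} {T : (V₁ → ℝ) →ₗ[ℝ] (V₂ → ℝ)} {C δ ρ : ℝ}
    (hC : 0 ≤ C) (hρ : ρ ≤ δ) (hdnn : ∀ a b : g.Site, 0 ≤ g.dist a b) (hlen : ∀ y : g.Site, 0 ≤ g.len y)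
    (h : HasMajorantHom (g := toB6 g R₀ H₀) blk₁ blk₂ T (fun (a b : g.Site) => C * g.len a * Real.exp (-(δ * g.dist a b)))) :
    HasMajorantHom (g := toB6 g R₀ H₀) blk₁ blk₂ T (fun (a b : g.Site) => C * g.len a * Real.exp (-(ρ * g.dist a b))) :=
  hasMajorantHom_mono (g := toB6 g R₀ H₀) _ _ h fun a b =>
    mul_le_mul_of_nonneg_left (Real.exp_le_exp.mpr (neg_le_neg (mul_le_mul_of_nonneg_right hρ (hdnn a b))))
      (mul_nonneg hC (hlen a))

/-- **G′D\* IN BLOCK-L² FROM THEOREM 3.1's SUP ENTRIES** ((3.46)₃-type for the site propagator): ‖1_{Δ(y)}G′D\*μ‖₂ ≦ B₀L₀·L^{j′}η·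
e^{−(1−α)δd(y,y′)}‖μ‖₂ (μ on the bond carrier, supp μ ⊂ Δ(y′)) — the sup majorants of G′D\* and of its transpose DG′ (`Thm31GpMaj.e2 ∕ e1`,
weakened to the rate δ of the member facts) through n06-k's `blockBd_entry2` read back through the adjoint (`blockBd_of_adjoint`); the transposition
letters D\*ᵀ = D, G′ᵀ = G′ (p. 391). [cite: Balaban1985BackgroundPropagators, Thm 3.1 (3.42)+(3.46) pp.397–398 + p.398 remark after (3.47) + p.391; Balaban1984PropagatorsII, Lemma 2.1 (2.60) p.234] -/
theorem blockBd_GpDvs (hG : GeoOK g) {dF : ℕ} {δ α L₀ : ℝ} (hF : Facts347 g R₀ H₀ dF δ α L₀) {blkW : W → g.Site} {blk : X → g.Site}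
    {Gp : Module.End ℝ (W → ℝ)} {Dv : (W → ℝ) →ₗ[ℝ] (X → ℝ)} {Dvs : (X → ℝ) →ₗ[ℝ] (W → ℝ)} {B₀ δ₀ : ℝ}
    (h31 : Thm31GpMaj blkW blk Gp Dv Dvs R₀ H₀ B₀ δ₀) (hB₀ : 0 ≤ B₀) (hδ : δ ≤ δ₀)
    (hGpT : IsTransposePair Gp Gp) (hDvT : IsTransposePair Dv Dvs) :
    BlockBd (g := toB6 g R₀ H₀) blk blkW (Gp ∘ₗ Dvs)
      (fun (y y' : g.Site) => B₀ * L₀ * g.len y' * Real.exp (-((1 - α) * δ * g.dist y y'))) := by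
  -- adapted from `B9Thm312WholeFromThm310L2.blockBd_l1_of_sup` (not imported: its import closure is rows 19's whole letter layer)
  have h1 := hom_rate_le hB₀ hδ hG.dnn hG.lenle h31.e2
  have h2 := hom_rate_le hB₀ hδ hG.dnn hG.lenle h31.e1
  -- (G′D*)ᵀ = DG′
  have htr : IsTransposePair (Gp ∘ₗ Dvs) (Dv ∘ₗ Gp) := hDvT.symm.comp hGpT
  have hL₀ : 0 ≤ L₀ := le_trans (le_trans zero_le_one hF.one_le_L) hF.L_le
  -- n06-k's output-scale bound for the transpose DG′, read back through the adjoint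
  have h2' := blockBd_entry2 hF hB₀ hG.symm hG.lenpos blk blkW h1 h2 htr
  have hadj : ∀ (u : W → ℝ) (v : X → ℝ), u ⬝ᵥ (Gp ∘ₗ Dvs) v = (Dv ∘ₗ Gp) u ⬝ᵥ v := fun u v => by
    rw [dotProduct_comm u ((Gp ∘ₗ Dvs) v), dotProduct_comm ((Dv ∘ₗ Gp) u) v]
    exact htr v u
  have h := blockBd_of_adjoint (g := toB6 g R₀ H₀) (blk₁ := blk) (blk₂ := blkW) (T := Gp ∘ₗ Dvs) (T' := Dv ∘ₗ Gp) hadj h2'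
    (fun y y' => mul_nonneg (mul_nonneg (mul_nonneg hB₀ hL₀) (hG.lenpos y).le) (Real.exp_nonneg _))
  refine h.mono fun y y' => le_of_eq ?_
  show B₀ * L₀ * g.len y' * Real.exp (-((1 - α) * δ * g.dist y' y)) = B₀ * L₀ * g.len y' * Real.exp (-((1 - α) * δ * g.dist y y'))
  rw [hG.symm y' y]

omit [Fintype X] in
/-- **P OF (3.49) IN BLOCK-L²** by the Schur test (P symmetric): ‖1_{Δ(y)}Pν‖₂ ≦ C_P·e^{−δ_Pd(y,y′)}‖ν‖₂.
[cite: Balaban1985BackgroundPropagators, (3.49) p.399 + (3.46) p.398 + p.391; Schur's test, folklore] -/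
theorem blockBd_P (hG : GeoOK g) {blkW : W → g.Site} {blk : X → g.Site} {P : Module.End ℝ (W → ℝ)} {Dv : (W → ℝ) →ₗ[ℝ] (X → ℝ)}
    {Dvs : (X → ℝ) →ₗ[ℝ] (W → ℝ)} {CP δP : ℝ} (h49 : Proj349Maj blkW blk P Dv Dvs R₀ H₀ CP δP) (hCP : 0 ≤ CP)
    (hPT : IsTransposePair P P) :
    BlockBd (g := toB6 g R₀ H₀) blkW blkW P (fun (y y' : g.Site) => CP * Real.exp (-(δP * g.dist y y'))) := by
  have hK : ∀ a b : g.Site, 0 ≤ CP * Real.exp (-(δP * g.dist a b)) := fun a b => mul_nonneg hCP (Real.exp_nonneg _)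
  have h0 : HasMajorantHom (g := toB6 g R₀ H₀) blkW blkW P (fun (a b : g.Site) => CP * Real.exp (-(δP * g.dist a b))) :=
    (hasMajorantHom_iff (g := toB6 g R₀ H₀) blkW P _).mpr h49.p0
  refine (blockBd_schur (G := toB6 g R₀ H₀) blkW blkW hK hK h0 h0 hPT).mono fun y y' => le_of_eq ?_
  show Real.sqrt (CP * Real.exp (-(δP * g.dist y y')) * (CP * Real.exp (-(δP * g.dist y' y)))) = CP * Real.exp (-(δP * g.dist y y'))
  rw [hG.symm y' y, Real.sqrt_mul_self (hK y y')]

omit [Fintype X] in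
/-- **P = I − ϱ⁻¹R IS SYMMETRIC WHEN R IS** (the letter `symmR` of `B9Thm312Whole.Identities`; at def-Y's pins `rcoK_eq` gives R = ϱ•(I − P) with
ϱ = c_R⁻¹ ≠ 0 and `isTransposePair_RcoK` gives Rᵀ = R) — supplies the hypothesis `hPT` of `rgdI_of_ids3152`. [cite: Balaban1985BackgroundPropagators, (3.17)–(3.22) pp.393–394 + (3.49) p.399 + p.391] -/
theorem isTransposePair_P_of_R {P R : Module.End ℝ (W → ℝ)} {ϱ : ℝ} (hR : R = ϱ • (LinearMap.id - P)) (hϱ : ϱ ≠ 0)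
    (hRT : IsTransposePair R R) : IsTransposePair P P := by
  have hP : P = LinearMap.id - ϱ⁻¹ • R := by
    rw [hR, smul_smul, inv_mul_cancel₀ hϱ, one_smul, sub_sub_cancel]
  have hsm : IsTransposePair (ϱ⁻¹ • R) (ϱ⁻¹ • R) := by
    intro u v
    simp only [LinearMap.smul_apply, Pi.smul_apply, smul_eq_mul]
    calc ∑ y, ϱ⁻¹ * R u y * v y = ϱ⁻¹ * ∑ y, R u y * v y := by
          rw [Finset.mul_sum]; exact Finset.sum_congr rfl fun y _ => by ring
      _ = ϱ⁻¹ * ∑ x, u x * R v x := by rw [hRT u v]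
      _ = ∑ x, u x * (ϱ⁻¹ * R v x) := by
          rw [Finset.mul_sum]; exact Finset.sum_congr rfl fun x _ => by ring
  rw [hP]
  exact isTransposePair_one.sub hsm

/-- ★ **THE BLOCK-L² LETTER RD\*G₁ OF ROWS 20–21 (`Letters313L2PZ.rgdI`) IS RG′D\* BY (3.152)**: ‖1_{Δ(y)}RD\*G₁μ‖₂ ≦ B₄·L^{j′}η·e^{−δ₄d(y,y′)}‖μ‖₂
for supp μ ⊂ Δ(y′) — PROVED from `Ids3152.rd`, Theorem 3.1 for G′ (`Thm31GpMaj`, derived h31), (3.49) (`Proj349Maj`, derived h49), R = ϱ•(I − P),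
the transposition letters (G′, P symmetric; Dᵀ = D\*), the member facts `Facts347` (at (δ, α), δ ≦ δ₀) and the row sum at the margin σ:
RG′D\* = ϱ(G′D\* − P(G′D\*)) with `blockBd_GpDvs`, `blockBd_P` and one composition ⇒ constant ϱ·B₀L₀·(1 + C_P·c), rate δ₄ ≦ (1 − α)δ with
δ₄ + σ ≦ δ_P.  Nothing of print asserted. [cite: Balaban1985BackgroundPropagators, (3.152)–(3.153) p.426 + Thm 3.1 (3.42)+(3.46) pp.397–398 + (3.49) p.399 + p.391 + Thm 3.13 p.426; Balaban1984PropagatorsII, (2.52)–(2.56) pp.232–233 + Lemma 2.1 (2.60)–(2.61) p.234] -/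
theorem rgdI_of_ids3152 (hG : GeoOK g) {dF : ℕ} {δ α L₀ σ c : ℝ} (hF : Facts347 g R₀ H₀ dF δ α L₀)
    (hrow : RowSum (toB6 g R₀ H₀) σ c) {𝔬 : Ops g B X Y Z W} {Gp P : B.Cfg → Module.End ℝ (W → ℝ)} {U : B.Cfg}
    {B₀ δ₀ CP δP ϱ B₄ δ₄ : ℝ}
    (h31 : Thm31GpMaj 𝔬.blkW 𝔬.blk (Gp U) (𝔬.Dv U) (𝔬.Dvstar U) R₀ H₀ B₀ δ₀)
    (h49 : Proj349Maj 𝔬.blkW 𝔬.blk (P U) (𝔬.Dv U) (𝔬.Dvstar U) R₀ H₀ CP δP)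
    (hR : 𝔬.R U = ϱ • (LinearMap.id - P U)) (h152 : Ids3152 𝔬 Gp U)
    (hGpT : IsTransposePair (Gp U) (Gp U)) (hDvT : IsTransposePair (𝔬.Dv U) (𝔬.Dvstar U)) (hPT : IsTransposePair (P U) (P U))
    (hϱ : 0 ≤ ϱ) (hB₀ : 0 ≤ B₀) (hCP : 0 ≤ CP) (hδ : δ ≤ δ₀)
    (hδ₄ : 0 ≤ δ₄) (hδ₄a : δ₄ ≤ (1 - α) * δ) (hδ₄P : δ₄ + σ ≤ δP)
    (hB₄ : ϱ * (B₀ * L₀ * (1 + CP * c)) ≤ B₄) :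
    BlockBd (g := toB6 g R₀ H₀) 𝔬.blk 𝔬.blkW (𝔬.R U ∘ₗ 𝔬.Dvstar U ∘ₗ 𝔬.G1 U ∘ₗ LinearMap.id)
      (fun (y y' : g.Site) => B₄ * g.len y' * Real.exp (-(δ₄ * g.dist y y'))) := by
  have htri : Triangle254 (toB6 g R₀ H₀) := fun a b c => hG.tri a b c
  have hL₀ : 0 ≤ L₀ := le_trans (le_trans zero_le_one hF.one_le_L) hF.L_le
  have hBL : 0 ≤ B₀ * L₀ := mul_nonneg hB₀ hL₀
  -- G′D* and P in block-L²
  have hGD := blockBd_GpDvs hG hF h31 hB₀ hδ hGpT hDvT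
  have hP := blockBd_P (X := X) hG h49 hCP hPT
  -- as majorants between the weighted block-L² spaces: source weight L^{j′}η on the bond carrier, weight 1 on the site carrier
  have hGD' : HasMaj (l2w (toB6 g R₀ H₀) 𝔬.blk (fun y => g.len y) hG.lenle) (l2w (toB6 g R₀ H₀) 𝔬.blkW (fun _ => (1 : ℝ)) fun _ => zero_le_one)
      (Gp U ∘ₗ 𝔬.Dvstar U) (fun a b => B₀ * L₀ * Real.exp (-((1 - α) * δ * g.dist a b))) :=
    hasMaj_l2w_of_blockBd (g := toB6 g R₀ H₀) hG.lenle (fun _ => zero_le_one) hGD fun y y' => le_of_eq (by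
      show (1 : ℝ) * (B₀ * L₀ * g.len y' * Real.exp (-((1 - α) * δ * g.dist y y'))) =
        B₀ * L₀ * Real.exp (-((1 - α) * δ * g.dist y y')) * g.len y'
      ring)
  have hP' : HasMaj (l2w (toB6 g R₀ H₀) 𝔬.blkW (fun _ => (1 : ℝ)) fun _ => zero_le_one)
      (l2w (toB6 g R₀ H₀) 𝔬.blkW (fun _ => (1 : ℝ)) fun _ => zero_le_one) (P U)
      (fun a b => CP * Real.exp (-(δP * g.dist a b))) :=
    (blockBd_iff_hasMaj (g := toB6 g R₀ H₀) 𝔬.blkW 𝔬.blkW (P U) _).mp hP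
  -- P ∘ (G′D*): one composition at the margin σ
  have hcomp : HasMaj (l2w (toB6 g R₀ H₀) 𝔬.blk (fun y => g.len y) hG.lenle) (l2w (toB6 g R₀ H₀) 𝔬.blkW (fun _ => (1 : ℝ)) fun _ => zero_le_one)
      (P U ∘ₗ (Gp U ∘ₗ 𝔬.Dvstar U)) (fun a b => CP * (B₀ * L₀) * c * Real.exp (-(δ₄ * g.dist a b))) := by
    refine (hasMaj_comp_exp htri hG.dnn hrow hCP hBL hδ₄ hδ₄a hδ₄P hP' hGD').mono fun a b => le_of_eq ?_
    simp only [l2w_κ, toB6_dist]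
    ring
  -- G′D* itself at the rate δ₄
  have hGD'' := hasMaj_weaken hG hBL le_rfl hδ₄a hGD'
  -- ϱ • (G′D* − P G′D*)
  have hsub := hasMaj_smul_l2w (hasMaj_sub_exp hGD'' hcomp) ϱ
  have hop : HasMaj (l2w (toB6 g R₀ H₀) 𝔬.blk (fun y => g.len y) hG.lenle) (l2w (toB6 g R₀ H₀) 𝔬.blkW (fun _ => (1 : ℝ)) fun _ => zero_le_one)
      (𝔬.R U ∘ₗ 𝔬.Dvstar U ∘ₗ 𝔬.G1 U ∘ₗ LinearMap.id)
      (fun a b => |ϱ| * ((B₀ * L₀ + CP * (B₀ * L₀) * c) * Real.exp (-(δ₄ * g.dist a b)))) := by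
    refine hsub.congr fun μ => ?_
    rw [h152.rd_apply μ, hR]
    simp only [LinearMap.smul_apply, LinearMap.sub_apply, LinearMap.comp_apply, LinearMap.id_apply]
  -- unscale: the source weight L^{j′}η returns to the kernel
  have hbd := blockBd_of_hasMaj_l2w (g := toB6 g R₀ H₀) hop fun _ => one_pos
  refine hbd.mono fun y y' => ?_
  show |ϱ| * ((B₀ * L₀ + CP * (B₀ * L₀) * c) * Real.exp (-(δ₄ * g.dist y y'))) * g.len y' / 1 ≤
    B₄ * g.len y' * Real.exp (-(δ₄ * g.dist y y'))
  rw [div_one, abs_of_nonneg hϱ]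
  have hK : ϱ * (B₀ * L₀ + CP * (B₀ * L₀) * c) ≤ B₄ := by
    calc ϱ * (B₀ * L₀ + CP * (B₀ * L₀) * c) = ϱ * (B₀ * L₀ * (1 + CP * c)) := by ring
      _ ≤ B₄ := hB₄
  calc ϱ * ((B₀ * L₀ + CP * (B₀ * L₀) * c) * Real.exp (-(δ₄ * g.dist y y'))) * g.len y'
      = ϱ * (B₀ * L₀ + CP * (B₀ * L₀) * c) * (g.len y' * Real.exp (-(δ₄ * g.dist y y'))) := by ring
    _ ≤ B₄ * (g.len y' * Real.exp (-(δ₄ * g.dist y y'))) :=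
        mul_le_mul_of_nonneg_right hK (mul_nonneg (hG.lenle y') (Real.exp_nonneg _))
    _ = B₄ * g.len y' * Real.exp (-(δ₄ * g.dist y y')) := by ring

end L2

end

end Literature.MathematicalPhysics.QuantumFieldTheory.Balaban1983to89.B9Thm313WholeRgdFrom3152
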